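import Summits.Ventures.LatticeQCDFlow.Scaling.LevelAutocorrelationFloor
import Summits.Ventures.LatticeQCDFlow.Scaling.SimulatedTemperingTarget

/-!
HONEST FRAMING: exact (Metropolis-corrected) sampling algorithms for lattice gauge theory; figures
of merit are autocorrelation/cost numbers at stated couplings and volumes; no continuum-physics
claim.

# SimulatedTemperingDiffusive — SIMULATED TEMPERING IN THE COUPLING IS DIFFUSIVE: FOR EVERY LADDER SIZE, EVERY
# WITHIN-LEVEL DYNAMICS AND EVERY COMPACT GAUGE GROUP, THE LEVEL'S STATIONARY LAG-ONE AUTOCORRELATION IS AT LEAST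
# `1 − 96/(e·m·(b−a)²)`, `m` A SPECIFIC-HEAT FLOOR ON `[a, b]` — `1 − O(e^{cB}/(⌊L/2⌋^d·(b−a)²))` FOR THE WILSON
# MEASURE AT EVERY COUPLING (lean-2 GEN-13, ours)

Venture-side (OURS).  Cell `lqcd-flow` (pub-lqcd), unit `pub-lqcd-lean-2-g13`, 2026-08-23.  GEN-11 priced the
LEVEL MOVE of simulated tempering / the expanded ensemble with exact weights
(`Scaling/SimulatedTemperingAcceptance`: its stationary acceptance between parameters `s → t` IS the overlap
`∫ min(p_s, p_t) ≤ exp(−m(t−s)²/8)`) and the number of levels it needs (`Ω((b−a)√m)`); round-trip /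
autocorrelation statements stayed NOT CLAIMED.  This file is the AUTOCORRELATION LAW OF THE LEVEL: the one-step
movement bound of `Scaling/LevelAutocorrelationFloor` applied to ANY Markov kernel `κ` on `Fin (K+1) × Ω` that
(i) leaves the exact-weight target `stTarget X μ β K` (`Scaling/SimulatedTemperingTarget`) invariant, (ii) moves
the level by at most one rung per step, and (iii) moves it up / down from `(k, x)` with probability at most the
exact-weight Metropolis ratio `min(1, p_{β_{k±1}}(x)/p_{β_k}(x))` — satisfied by every Metropolis,
Metropolis–Hastings or neighbour-Gibbs level update with exact weights taken ALONE, in a MIXTURE with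
`μ_{β_k}`-preserving within-level kernels (heat bath, over-relaxation, HMC, flow proposals …), or FOLLOWED by
them within one step (an implementation that relaxes first and then updates the level has the same stationary
level process shifted by one step, hence the same level autocorrelations).  Then the ladder-size-free form:
GEN-11's overlap ceiling under a variance floor and `Scaling/LevelAutocorrelationFloor.ladder_rate_kfree`
(`12e^{−A/K²}/((K+1)(K+2)) ≤ 12/(eA)` for every `K ≥ 1`) — refining the ladder makes level moves likely but the
level must diffuse over more rungs, coarsening it makes them exponentially rare; the product is free of `K`.

## What is proved (`μ` probability, `X` bounded measurable, `μ_u = μ.tilted(u·X)`, `p_u = e^{uX}/mgf(u)`)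

* §2 **`st_moveRate_le`** — under (iii) the stationary level-move rate is at most
  `ā_K := (2/(K+1))·Σ_{k<K} ∫ min(p_{β_k}, p_{β_{k+1}}) dμ` (GEN-11's `stAcc_eq_overlap`, both directions);
  **`st_level_lagOneAutocorr_ge`** — under (i)–(iii) and `K ≥ 1`, with
  `ρ_lev(1) = Cov_π(k₀, k₁)/Var_π(k) = (E_π[k₀k₁] − (K/2)²)/(K(K+2)/12)` the stationary lag-one
  autocorrelation of the level along the chain: `1 − 6ā_K/(K(K+2)) ≤ ρ_lev(1)`.
* §3 (uniform ladder `β_k = a + k(b−a)/K`, `a < b`, `K ≥ 1`, variance floor `0 < m ≤ Var_{μ_u}(X)` on `[a, b]`;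
  `ā_K ≤ (2K/(K+1))·exp(−m(b−a)²/(8K²))` is `SimulatedTemperingTarget.st_moveRate_le_ladder`): THE
  LADDER-SIZE-FREE LAW **`st_level_lagOneAutocorr_ge_kfree`** — `1 − 96/(e·m·(b−a)²) ≤ ρ_lev(1)` for EVERY `K`.
* §4 the Wilson coupling family of every compact `G` (`Ω = G^E`, `μ = D[U]` the Haar product, `X = −S_W`, so
  `μ_u` is the Wilson measure at coupling `u`; unitary continuous `ρ`, `d ≥ 2`, `L ≥ 2`, `Var_Haar(Re tr ρ) > 0`,
  `−B ≤ a < b ≤ B`, `K ≥ 1`): **`wilson_st_level_lagOneAutocorr_ge_allCouplings`** —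
  `1 − 96·exp(B·2NK'(1+4K'))/(e·⌊L/2⌋^d·Var_Haar(Re tr ρ)·(b−a)²) ≤ ρ_lev(1)`, `K' = (d+1)d²`, for every number of
  levels and every within-level algorithm (GEN-9's all-coupling specific-heat floor
  `TrivializingMaps/WilsonVarianceFloorAllCouplings`).

Reading (no numerics implied): simulated tempering across a coupling window `[a, b]` cannot refresh its level
faster than a random walk whose steps succeed with the overlap of adjacent Wilson measures; optimising the
number of levels still leaves `1 − ρ_lev(1) ≤ 96/(e·m·(b−a)²)` with `m` the smallest heat capacity
`Var_u(S_W)` on the window — extensive in the volume at every coupling — so the level needs `Ω(m·(b−a)²)`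
updates to decorrelate, i.e. `Ω(volume·(b−a)²)` per independent visit of the target coupling, whatever
happens within the levels.  The Wilson constant is GEN-9's (structural, astronomically weak at large `B`); the
abstract law takes any floor `m` (the measured specific heat in practice; the pinched two-dimensional and the
strong-coupling floors of the tree give realistic constants).  NOT CLAIMED: non-exact weights; non-uniform
ladders in the `K`-free form (the level law itself is ladder-agnostic); parallel tempering / PTBC; `τ_int`,
round trips, spectral gaps; any measured number.  Literature grade (cell rule): KNOWN MECHANISM
(Katzgraber–Trebst–Huse–Troyer, J. Stat. Mech. (2006) P03018: diffusive ladder motion and `√C_V` spacing;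
Woodard–Schmidler–Huber, Electron. J. Probab. 14 (2009) 780: torpid mixing via adjacent overlaps), NEW TYPING
(kernel level, ladder-size-free constant, every compact gauge group at every coupling); nothing cited as a fact.
-/

noncomputable section

open MeasureTheory ProbabilityTheory Set Filter Finset
open Literature.MathematicalPhysics.QuantumFieldTheory
open Literature.MathematicalPhysics.QuantumFieldTheory.Luscher2010
open Summit.Ventures.LatticeQCDFlow.Scoring
open Summit.Ventures.LatticeQCDFlow.TrivializingMaps
open scoped ENNReal

namespace Summit.Ventures.LatticeQCDFlow.Scaling

/-! ## §2 The level autocorrelation of ANY exact simulated-tempering kernel -/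

section Law

variable {Ω : Type*} [MeasurableSpace Ω] {X : Ω → ℝ} {μ : Measure Ω} [IsProbabilityMeasure μ]
  {β : ℕ → ℝ} {K : ℕ}

/-- **THE STATIONARY LEVEL-MOVE RATE IS AT MOST `(2/(K+1))·Σ_{k<K} ∫ min(p_{β_k}, p_{β_{k+1}}) dμ`** for every
kernel whose up / down level moves from `(k, x)` happen with probability at most the exact-weight Metropolis
ratios `min(1, p_{β_{k±1}}(x)/p_{β_k}(x))`: the integral of the dominating rate against the target. [ours] -/
theorem st_moveRate_le (hXm : Measurable X) (hXb : ∃ C, ∀ x, |X x| ≤ C) :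
    ∫ z, stLevelMoveRatio X μ β K z ∂(stTarget X μ β K) ≤
      2 / (K + 1) * ∑ k ∈ range K, ∫ x, min (Real.exp (β k * X x) / mgf X μ (β k))
        (Real.exp (β (k + 1) * X x) / mgf X μ (β (k + 1))) ∂μ := by
  have hrb : ∀ z, |stLevelMoveRatio X μ β K z| ≤ 2 := fun z => by
    rw [abs_of_nonneg (stLevelMoveRatio_nonneg hXm hXb z)]; exact stLevelMoveRatio_le_two z
  rw [integral_stTarget (measurable_stLevelMoveRatio hXm) hrb]
  -- per level: the two Metropolis ratios integrate to the overlaps (GEN-11's `stAcc_eq_overlap`)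
  set ovl : ℕ → ℝ := fun k => ∫ x, min (Real.exp (β k * X x) / mgf X μ (β k))
    (Real.exp (β (k + 1) * X x) / mgf X μ (β (k + 1))) ∂μ with hovl
  have hk_int : ∀ k : Fin (K + 1), ∫ x, stLevelMoveRatio X μ β K (k, x) ∂(μ.tilted fun x => β k * X x) =
      (if ((k : Fin (K + 1)) : ℕ) < K then ovl k else 0) +
        (if 1 ≤ ((k : Fin (K + 1)) : ℕ) then ovl ((k : ℕ) - 1) else 0) := by
    intro k
    haveI := isProbabilityMeasure_tilted_mul (μ := μ) hXm hXb (β k)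
    have hup : ∫ x, (if ((k : Fin (K + 1)) : ℕ) < K then
        min 1 ((Real.exp (β ((k : ℕ) + 1) * X x) / mgf X μ (β ((k : ℕ) + 1))) /
          (Real.exp (β (k : ℕ) * X x) / mgf X μ (β (k : ℕ)))) else 0) ∂(μ.tilted fun x => β k * X x) =
        if ((k : Fin (K + 1)) : ℕ) < K then ovl k else 0 := by
      split_ifs with hk
      · rw [hovl]; exact stAcc_eq_overlap hXm hXb (β k) (β (k + 1))
      · simp
    have hdown : ∫ x, (if 1 ≤ ((k : Fin (K + 1)) : ℕ) then
        min 1 ((Real.exp (β ((k : ℕ) - 1) * X x) / mgf X μ (β ((k : ℕ) - 1))) /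
          (Real.exp (β (k : ℕ) * X x) / mgf X μ (β (k : ℕ)))) else 0) ∂(μ.tilted fun x => β k * X x) =
        if 1 ≤ ((k : Fin (K + 1)) : ℕ) then ovl ((k : ℕ) - 1) else 0 := by
      split_ifs with hk
      · rw [hovl, stAcc_eq_overlap hXm hXb (β k) (β ((k : ℕ) - 1))]
        simp only [Nat.sub_add_cancel hk]
        exact integral_congr_ae (ae_of_all _ fun x => min_comm _ _)
      · simp
    have i1 : Integrable (fun x => if ((k : Fin (K + 1)) : ℕ) < K then
        min 1 ((Real.exp (β ((k : ℕ) + 1) * X x) / mgf X μ (β ((k : ℕ) + 1))) /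
          (Real.exp (β (k : ℕ) * X x) / mgf X μ (β (k : ℕ)))) else 0) (μ.tilted fun x => β k * X x) := by
      split_ifs
      · refine Integrable.of_bound ((measurable_const.min (((Real.measurable_exp.comp
          (hXm.const_mul _)).div_const _).div ((Real.measurable_exp.comp (hXm.const_mul _)).div_const _)))
          |>.aestronglyMeasurable) 1 (ae_of_all _ fun x => ?_)
        rw [Real.norm_eq_abs, abs_of_nonneg (le_min zero_le_one (div_nonneg
          (div_nonneg (Real.exp_pos _).le (mgf_pos_of_bounded hXm hXb _).le)
          (div_nonneg (Real.exp_pos _).le (mgf_pos_of_bounded hXm hXb _).le)))]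
        exact min_le_left _ _
      · exact integrable_const _
    have i2 : Integrable (fun x => if 1 ≤ ((k : Fin (K + 1)) : ℕ) then
        min 1 ((Real.exp (β ((k : ℕ) - 1) * X x) / mgf X μ (β ((k : ℕ) - 1))) /
          (Real.exp (β (k : ℕ) * X x) / mgf X μ (β (k : ℕ)))) else 0) (μ.tilted fun x => β k * X x) := by
      split_ifs
      · refine Integrable.of_bound ((measurable_const.min (((Real.measurable_exp.comp
          (hXm.const_mul _)).div_const _).div ((Real.measurable_exp.comp (hXm.const_mul _)).div_const _)))
          |>.aestronglyMeasurable) 1 (ae_of_all _ fun x => ?_)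
        rw [Real.norm_eq_abs, abs_of_nonneg (le_min zero_le_one (div_nonneg
          (div_nonneg (Real.exp_pos _).le (mgf_pos_of_bounded hXm hXb _).le)
          (div_nonneg (Real.exp_pos _).le (mgf_pos_of_bounded hXm hXb _).le)))]
        exact min_le_left _ _
      · exact integrable_const _
    unfold stLevelMoveRatio
    rw [integral_add i1 i2, hup, hdown]
  simp only [hk_int, Finset.sum_add_distrib]
  -- re-index the two sums over `Fin (K+1)` as sums over `range K`
  have hs1 : ∑ k : Fin (K + 1), (if ((k : Fin (K + 1)) : ℕ) < K then ovl k else 0) = ∑ k ∈ range K, ovl k := by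
    rw [Fin.sum_univ_eq_sum_range (fun k => if k < K then ovl k else 0) (K + 1), Finset.sum_range_succ,
      if_neg (lt_irrefl K), add_zero]
    exact Finset.sum_congr rfl fun k hk => if_pos (Finset.mem_range.1 hk)
  have hs2 : ∑ k : Fin (K + 1), (if 1 ≤ ((k : Fin (K + 1)) : ℕ) then ovl ((k : ℕ) - 1) else 0) =
      ∑ k ∈ range K, ovl k := by
    rw [Fin.sum_univ_eq_sum_range (fun k => if 1 ≤ k then ovl (k - 1) else 0) (K + 1), Finset.sum_range_succ']
    simp
  rw [hs1, hs2]
  have hK1 : (0 : ℝ) < K + 1 := by positivity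
  rw [div_mul_eq_mul_div, div_mul_eq_mul_div, one_mul]
  rw [div_le_div_iff_of_pos_right hK1]
  linarith

/-- **THE LEVEL AUTOCORRELATION LAW OF EXACT SIMULATED TEMPERING** (`μ` probability, `X` bounded measurable,
levels `β_0, …, β_K`, `K ≥ 1`).  Let `κ` be ANY Markov kernel on `Fin (K+1) × Ω` that (i) leaves the
exact-weight target `stTarget X μ β K` invariant, (ii) moves the level by at most one rung per step
(`κ(z,·)`-a.e.), and (iii) moves it up / down from `(k, x)` with probability at most
`min(1, p_{β_{k±1}}(x)/p_{β_k}(x))`.  Then the stationary lag-one autocorrelation of the level,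
`ρ_lev(1) = (E_π[k₀k₁] − (K/2)²)/(K(K+2)/12)`, satisfies
`1 − 6ā_K/(K(K+2)) ≤ ρ_lev(1)`, `ā_K = (2/(K+1))·Σ_{k<K} ∫ min(p_{β_k}, p_{β_{k+1}}) dμ`. [ours] -/
theorem st_level_lagOneAutocorr_ge (hXm : Measurable X) (hXb : ∃ C, ∀ x, |X x| ≤ C) (hK : 1 ≤ K)
    (κ : Kernel (Fin (K + 1) × Ω) (Fin (K + 1) × Ω)) [IsMarkovKernel κ]
    (hinv : Kernel.Invariant κ (stTarget X μ β K))
    (hnn : ∀ z, ∀ᵐ y ∂(κ z), |(((y.1 : Fin (K + 1)) : ℕ) : ℝ) - ((z.1 : Fin (K + 1)) : ℕ)| ≤ 1)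
    (hup : ∀ (k : Fin (K + 1)) (x : Ω), (k : ℕ) < K →
      (κ (k, x)).real {y | ((y.1 : Fin (K + 1)) : ℕ) = (k : ℕ) + 1} ≤
        min 1 ((Real.exp (β ((k : ℕ) + 1) * X x) / mgf X μ (β ((k : ℕ) + 1))) /
          (Real.exp (β (k : ℕ) * X x) / mgf X μ (β (k : ℕ)))))
    (hdown : ∀ (k : Fin (K + 1)) (x : Ω), 1 ≤ (k : ℕ) →
      (κ (k, x)).real {y | ((y.1 : Fin (K + 1)) : ℕ) + 1 = (k : ℕ)} ≤
        min 1 ((Real.exp (β ((k : ℕ) - 1) * X x) / mgf X μ (β ((k : ℕ) - 1))) /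
          (Real.exp (β (k : ℕ) * X x) / mgf X μ (β (k : ℕ))))) :
    1 - 6 * (2 / (K + 1) * ∑ k ∈ range K, ∫ x, min (Real.exp (β (k : ℕ) * X x) / mgf X μ (β (k : ℕ)))
        (Real.exp (β ((k : ℕ) + 1) * X x) / mgf X μ (β ((k : ℕ) + 1))) ∂μ) / (K * (K + 2)) ≤
      (autocov κ (stTarget X μ β K) (fun z => (((z.1 : Fin (K + 1)) : ℕ) : ℝ)) 1 - ((K : ℝ) / 2) ^ 2) /
        (K * (K + 2) / 12) := by
  haveI := isProbabilityMeasure_stTarget (μ := μ) (β := β) (K := K) hXm hXb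
  -- the dominating rate bounds the probability that the level moves
  have hrate : ∀ z : Fin (K + 1) × Ω, (κ z).real {y | ((y.1 : Fin (K + 1)) : ℕ) ≠ ((z.1 : Fin (K + 1)) : ℕ)}
      ≤ stLevelMoveRatio X μ β K z := by
    rintro ⟨k, x⟩
    -- `{lev ≠ k} ⊆ {lev = k+1} ∪ {lev + 1 = k} ∪ N`, `N` the null set where the level jumps by more than one
    have hsub : {y : Fin (K + 1) × Ω | ((y.1 : Fin (K + 1)) : ℕ) ≠ k} ⊆
        ({y | ((y.1 : Fin (K + 1)) : ℕ) = k + 1} ∪ {y | ((y.1 : Fin (K + 1)) : ℕ) + 1 = k}) ∪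
          {y | ¬ (|(((y.1 : Fin (K + 1)) : ℕ) : ℝ) - ((k : Fin (K + 1)) : ℕ)| ≤ 1)} := by
      intro y hy
      simp only [Set.mem_setOf_eq, Set.mem_union] at hy ⊢
      by_cases h : |(((y.1 : Fin (K + 1)) : ℕ) : ℝ) - ((k : Fin (K + 1)) : ℕ)| ≤ 1
      · left
        rw [abs_le] at h
        obtain ⟨h1, h2⟩ := h
        have h1' : ((k : Fin (K + 1)) : ℕ) ≤ ((y.1 : Fin (K + 1)) : ℕ) + 1 := by
          have : ((k : ℕ) : ℝ) ≤ ((y.1 : ℕ) : ℝ) + 1 := by linarith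
          exact_mod_cast this
        have h2' : ((y.1 : Fin (K + 1)) : ℕ) ≤ ((k : Fin (K + 1)) : ℕ) + 1 := by
          have : ((y.1 : ℕ) : ℝ) ≤ ((k : ℕ) : ℝ) + 1 := by linarith
          exact_mod_cast this
        omega
      · right; exact h
    have hN : (κ (k, x)) {y | ¬ (|(((y.1 : Fin (K + 1)) : ℕ) : ℝ) - ((k : Fin (K + 1)) : ℕ)| ≤ 1)} = 0 := by
      have h := hnn (k, x)
      rw [ae_iff] at h
      exact h
    have hle : (κ (k, x)).real {y : Fin (K + 1) × Ω | ((y.1 : Fin (K + 1)) : ℕ) ≠ k} ≤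
        (κ (k, x)).real {y | ((y.1 : Fin (K + 1)) : ℕ) = k + 1} +
          (κ (k, x)).real {y | ((y.1 : Fin (K + 1)) : ℕ) + 1 = k} := by
      calc (κ (k, x)).real {y : Fin (K + 1) × Ω | ((y.1 : Fin (K + 1)) : ℕ) ≠ k}
          ≤ (κ (k, x)).real (({y | ((y.1 : Fin (K + 1)) : ℕ) = k + 1} ∪ {y | ((y.1 : Fin (K + 1)) : ℕ) + 1 = k})
              ∪ {y | ¬ (|(((y.1 : Fin (K + 1)) : ℕ) : ℝ) - ((k : Fin (K + 1)) : ℕ)| ≤ 1)}) :=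
            measureReal_mono hsub
        _ ≤ (κ (k, x)).real ({y | ((y.1 : Fin (K + 1)) : ℕ) = k + 1} ∪ {y | ((y.1 : Fin (K + 1)) : ℕ) + 1 = k})
              + (κ (k, x)).real {y | ¬ (|(((y.1 : Fin (K + 1)) : ℕ) : ℝ) - ((k : Fin (K + 1)) : ℕ)| ≤ 1)} :=
            measureReal_union_le _ _
        _ ≤ (κ (k, x)).real {y | ((y.1 : Fin (K + 1)) : ℕ) = k + 1} +
              (κ (k, x)).real {y | ((y.1 : Fin (K + 1)) : ℕ) + 1 = k} + 0 := by
            gcongr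
            · exact measureReal_union_le _ _
            · rw [measureReal_def, hN, ENNReal.toReal_zero]
        _ = _ := add_zero _
    refine hle.trans (add_le_add ?_ ?_)
    · by_cases hk : ((k : Fin (K + 1)) : ℕ) < K
      · simp only [hk, if_true]
        exact hup k x hk
      · have hempty : {y : Fin (K + 1) × Ω | ((y.1 : Fin (K + 1)) : ℕ) = k + 1} = ∅ := by
          ext y
          simp only [Set.mem_setOf_eq, Set.mem_empty_iff_false, iff_false]
          have := y.1.isLt
          omega
        simp only [hempty, measureReal_empty, hk, if_false, le_refl]
    · by_cases hk : 1 ≤ ((k : Fin (K + 1)) : ℕ)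
      · simp only [hk, if_true]
        exact hdown k x hk
      · have hempty : {y : Fin (K + 1) × Ω | ((y.1 : Fin (K + 1)) : ℕ) + 1 = k} = ∅ := by
          ext y
          simp only [Set.mem_setOf_eq, Set.mem_empty_iff_false, iff_false]
          omega
        simp only [hempty, measureReal_empty, hk, if_false, le_refl]
  have h := level_lagOneAutocorr_ge (lev := fun z : Fin (K + 1) × Ω => ((z.1 : Fin (K + 1)) : ℕ))
    hinv measurable_stLevel (fun z => Nat.le_of_lt_succ z.1.isLt) hK
    (fun k hk => stTarget_real_level hXm hXb k hk) hnn (measurable_stLevelMoveRatio hXm) (R := 2)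
    (stLevelMoveRatio_nonneg hXm hXb) stLevelMoveRatio_le_two hrate
  refine le_trans ?_ h
  have hKpos : (0 : ℝ) < K * (K + 2) := by
    have : (1 : ℝ) ≤ K := by exact_mod_cast hK
    positivity
  have hmove := st_moveRate_le (μ := μ) (β := β) (K := K) hXm hXb
  gcongr

end Law

/-! ## §3 Uniform ladders under a variance floor: the ladder-size-free law -/

section Ladder

variable {Ω : Type*} [MeasurableSpace Ω] {X : Ω → ℝ} {μ : Measure Ω} [IsProbabilityMeasure μ] {K : ℕ}

/-- **THE LADDER-SIZE-FREE LAW.**  Uniform ladder `β_k = a + k(b−a)/K` from `a` to `b > a` with `K ≥ 1` levels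
above the bottom, variance floor `0 < m ≤ Var_{μ_u}(X)` on `[a, b]`; `κ` any Markov kernel on `Fin (K+1) × Ω`
satisfying (i)–(iii) of `st_level_lagOneAutocorr_ge` for this ladder.  Then, WHATEVER `K`,
`1 − 96/(e·m·(b−a)²) ≤ ρ_lev(1)`. [ours] -/
theorem st_level_lagOneAutocorr_ge_kfree (hXm : Measurable X) (hXb : ∃ C, ∀ x, |X x| ≤ C) {a b m : ℝ}
    (hab : a < b) (hm0 : 0 < m) (hm : ∀ u ∈ Icc a b, m ≤ variance X (μ.tilted fun x => u * X x))
    (hK : 1 ≤ K) (κ : Kernel (Fin (K + 1) × Ω) (Fin (K + 1) × Ω)) [IsMarkovKernel κ]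
    (hinv : Kernel.Invariant κ (stTarget X μ (fun k => a + k * ((b - a) / K)) K))
    (hnn : ∀ z, ∀ᵐ y ∂(κ z), |(((y.1 : Fin (K + 1)) : ℕ) : ℝ) - ((z.1 : Fin (K + 1)) : ℕ)| ≤ 1)
    (hup : ∀ (k : Fin (K + 1)) (x : Ω), (k : ℕ) < K →
      (κ (k, x)).real {y | ((y.1 : Fin (K + 1)) : ℕ) = (k : ℕ) + 1} ≤
        min 1 ((Real.exp ((a + (((k : ℕ) + 1 : ℕ) : ℝ) * ((b - a) / K)) * X x) / mgf X μ (a + (((k : ℕ) + 1 : ℕ) : ℝ) * ((b - a) / K))) /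
          (Real.exp ((a + ((k : ℕ) : ℝ) * ((b - a) / K)) * X x) / mgf X μ (a + ((k : ℕ) : ℝ) * ((b - a) / K)))))
    (hdown : ∀ (k : Fin (K + 1)) (x : Ω), 1 ≤ (k : ℕ) →
      (κ (k, x)).real {y | ((y.1 : Fin (K + 1)) : ℕ) + 1 = (k : ℕ)} ≤
        min 1 ((Real.exp ((a + (((k : ℕ) - 1 : ℕ) : ℝ) * ((b - a) / K)) * X x) / mgf X μ (a + (((k : ℕ) - 1 : ℕ) : ℝ) * ((b - a) / K))) /
          (Real.exp ((a + ((k : ℕ) : ℝ) * ((b - a) / K)) * X x) / mgf X μ (a + ((k : ℕ) : ℝ) * ((b - a) / K))))) :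
    1 - 96 / (Real.exp 1 * m * (b - a) ^ 2) ≤
      (autocov κ (stTarget X μ (fun k => a + k * ((b - a) / K)) K)
          (fun z => (((z.1 : Fin (K + 1)) : ℕ) : ℝ)) 1 - ((K : ℝ) / 2) ^ 2) / (K * (K + 2) / 12) := by
  have h := st_level_lagOneAutocorr_ge (β := fun k => a + k * ((b - a) / K)) hXm hXb hK κ hinv hnn
    (fun k x hk => by simpa [Nat.cast_add, Nat.cast_one] using hup k x hk)
    (fun k x hk => by simpa using hdown k x hk)
  refine le_trans ?_ h
  have hrate := st_moveRate_le_ladder (μ := μ) hXm hXb hab.le hK hm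
  have hKr : (1 : ℝ) ≤ K := by exact_mod_cast hK
  have hKpos : (0 : ℝ) < K * (K + 2) := by positivity
  -- `6ā/(K(K+2)) ≤ 12e^{−A/K²}/((K+1)(K+2)) ≤ 12/(eA)`, `A = m(b−a)²/8`
  have hA : 0 < m * (b - a) ^ 2 / 8 := by
    have : 0 < (b - a) ^ 2 := by nlinarith
    positivity
  have hkfree := ladder_rate_kfree hA hKr
  have e1 : -(m * (b - a) ^ 2 / 8 / (K : ℝ) ^ 2) = -(m * (b - a) ^ 2 / (8 * K ^ 2)) := by
    rw [div_div]
  rw [e1] at hkfree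
  have e2 : 12 / (Real.exp 1 * (m * (b - a) ^ 2 / 8)) = 96 / (Real.exp 1 * m * (b - a) ^ 2) := by
    field_simp
    ring
  rw [e2] at hkfree
  have hchain : 6 * (2 / (K + 1) * ∑ k ∈ range K, ∫ x, min (Real.exp ((a + k * ((b - a) / K)) * X x) /
          mgf X μ (a + k * ((b - a) / K)))
        (Real.exp ((a + (k + 1 : ℕ) * ((b - a) / K)) * X x) / mgf X μ (a + (k + 1 : ℕ) * ((b - a) / K))) ∂μ) /
        (K * (K + 2)) ≤ 12 * Real.exp (-(m * (b - a) ^ 2 / (8 * K ^ 2))) / ((K + 1) * (K + 2)) := by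
    calc 6 * (2 / (K + 1) * ∑ k ∈ range K, ∫ x, min (Real.exp ((a + k * ((b - a) / K)) * X x) /
            mgf X μ (a + k * ((b - a) / K)))
          (Real.exp ((a + (k + 1 : ℕ) * ((b - a) / K)) * X x) / mgf X μ (a + (k + 1 : ℕ) * ((b - a) / K))) ∂μ) /
          (K * (K + 2))
        ≤ 6 * (2 * K / (K + 1) * Real.exp (-(m * (b - a) ^ 2 / (8 * K ^ 2)))) / (K * (K + 2)) := by
          gcongr
      _ = 12 * Real.exp (-(m * (b - a) ^ 2 / (8 * K ^ 2))) / ((K + 1) * (K + 2)) := by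
          field_simp
          ring
  have hsum : (fun k : ℕ => ∫ x, min (Real.exp ((a + k * ((b - a) / K)) * X x) / mgf X μ (a + k * ((b - a) / K)))
      (Real.exp ((a + (k + 1 : ℕ) * ((b - a) / K)) * X x) / mgf X μ (a + (k + 1 : ℕ) * ((b - a) / K))) ∂μ) =
      fun k : ℕ => ∫ x, min (Real.exp ((a + k * ((b - a) / K)) * X x) / mgf X μ (a + k * ((b - a) / K)))
      (Real.exp ((a + ((k + 1 : ℕ) : ℝ) * ((b - a) / K)) * X x) /
        mgf X μ (a + ((k + 1 : ℕ) : ℝ) * ((b - a) / K))) ∂μ := rfl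
  linarith [hchain, hkfree]

end Ladder

/-! ## §4 The Wilson coupling family, every compact gauge group, every coupling -/

section Wilson

variable {d L N : ℕ} [NeZero L] {G : Type*} [Group G] [TopologicalSpace G] [IsTopologicalGroup G]
  [CompactSpace G] [MeasurableSpace G] [BorelSpace G] [SecondCountableTopology G]
  (ρ : G →* Matrix (Fin N) (Fin N) ℂ)

/-- **SIMULATED TEMPERING IN THE WILSON COUPLING IS DIFFUSIVE AT EVERY COUPLING, FOR EVERY COMPACT GAUGE GROUP**
(unitary continuous `ρ`, `d ≥ 2`, `L ≥ 2`, `Var_Haar(Re tr ρ) > 0`, `−B ≤ a < b ≤ B`, `K ≥ 1`; `X = −S_W` over the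
Haar product `D[U]`, so `μ_u` is the Wilson measure at coupling `u`).  For EVERY Markov kernel on
`Fin (K+1) × G^E` that leaves the exact-weight simulated-tempering target over the uniform ladder from `a` to `b`
invariant, moves the level by at most one rung, and moves it up / down with probability at most the
exact-weight Metropolis ratios:
`1 − 96·exp(B·2NK'(1+4K'))/(e·⌊L/2⌋^d·Var_Haar(Re tr ρ)·(b−a)²) ≤ ρ_lev(1)`, `K' = (d+1)d²`. [ours] -/
theorem wilson_st_level_lagOneAutocorr_ge_allCouplings (hd : 2 ≤ d) (hL : 2 ≤ L) (hρ : Continuous ρ)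
    (hρu : ∀ g, ρ g ∈ Matrix.unitaryGroup (Fin N) ℂ)
    (hv : 0 < variance (fun g => (ρ g).trace.re) (haarProbability G)) {a b B : ℝ} (ha : -B ≤ a)
    (hab : a < b) (hb : b ≤ B) {K : ℕ} (hK : 1 ≤ K)
    (κ : Kernel (Fin (K + 1) × GaugeConfig d L G) (Fin (K + 1) × GaugeConfig d L G)) [IsMarkovKernel κ]
    (hinv : Kernel.Invariant κ (stTarget (fun U => -wilsonAction ρ U) (trivialMeasure G d L)
      (fun k => a + k * ((b - a) / K)) K))
    (hnn : ∀ z, ∀ᵐ y ∂(κ z), |(((y.1 : Fin (K + 1)) : ℕ) : ℝ) - ((z.1 : Fin (K + 1)) : ℕ)| ≤ 1)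
    (hup : ∀ (k : Fin (K + 1)) (U : GaugeConfig d L G), (k : ℕ) < K →
      (κ (k, U)).real {y | ((y.1 : Fin (K + 1)) : ℕ) = (k : ℕ) + 1} ≤
        min 1 ((Real.exp ((a + (((k : ℕ) + 1 : ℕ) : ℝ) * ((b - a) / K)) * (-wilsonAction ρ U)) /
            mgf (fun U => -wilsonAction ρ U) (trivialMeasure G d L) (a + (((k : ℕ) + 1 : ℕ) : ℝ) * ((b - a) / K))) /
          (Real.exp ((a + ((k : ℕ) : ℝ) * ((b - a) / K)) * (-wilsonAction ρ U)) /
            mgf (fun U => -wilsonAction ρ U) (trivialMeasure G d L) (a + ((k : ℕ) : ℝ) * ((b - a) / K)))))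
    (hdown : ∀ (k : Fin (K + 1)) (U : GaugeConfig d L G), 1 ≤ (k : ℕ) →
      (κ (k, U)).real {y | ((y.1 : Fin (K + 1)) : ℕ) + 1 = (k : ℕ)} ≤
        min 1 ((Real.exp ((a + (((k : ℕ) - 1 : ℕ) : ℝ) * ((b - a) / K)) * (-wilsonAction ρ U)) /
            mgf (fun U => -wilsonAction ρ U) (trivialMeasure G d L) (a + (((k : ℕ) - 1 : ℕ) : ℝ) * ((b - a) / K))) /
          (Real.exp ((a + ((k : ℕ) : ℝ) * ((b - a) / K)) * (-wilsonAction ρ U)) /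
            mgf (fun U => -wilsonAction ρ U) (trivialMeasure G d L) (a + ((k : ℕ) : ℝ) * ((b - a) / K))))) :
    1 - 96 * Real.exp (B * (2 * N * ((d + 1) * d ^ 2 : ℕ) * (1 + 4 * ((d + 1) * d ^ 2 : ℕ)))) /
        (Real.exp 1 * (((L / 2) ^ d : ℕ) * variance (fun g => (ρ g).trace.re) (haarProbability G)) *
          (b - a) ^ 2) ≤
      (autocov κ (stTarget (fun U => -wilsonAction ρ U) (trivialMeasure G d L)
            (fun k => a + k * ((b - a) / K)) K)
          (fun z => (((z.1 : Fin (K + 1)) : ℕ) : ℝ)) 1 - ((K : ℝ) / 2) ^ 2) / (K * (K + 2) / 12) := by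
  haveI : IsProbabilityMeasure (trivialMeasure G d L) := trivialMeasure_isProbabilityMeasure
  set m : ℝ := Real.exp (-(B * (2 * N * ((d + 1) * d ^ 2 : ℕ) * (1 + 4 * ((d + 1) * d ^ 2 : ℕ))))) *
    ((L / 2) ^ d : ℕ) * variance (fun g => (ρ g).trace.re) (haarProbability G) with hm_def
  have hLd : 0 < ((L / 2) ^ d : ℕ) := by
    have : 1 ≤ L / 2 := Nat.le_div_iff_mul_le (by norm_num) |>.2 (by omega)
    exact pow_pos (by omega) d
  have hm0 : 0 < m := by
    rw [hm_def]
    refine mul_pos (mul_pos (Real.exp_pos _) ?_) hv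
    exact_mod_cast hLd
  -- the all-coupling floor `m ≤ Var_u(S_W) = Var_{μ_u}(X)` on `[a,b] ⊆ [−B,B]`
  have hfloor : ∀ u ∈ Icc a b, m ≤ variance (fun U => -wilsonAction ρ U)
      ((trivialMeasure G d L).tilted fun U => u * (-wilsonAction ρ U)) := by
    intro u hu
    rw [tilted_neg_wilsonAction_eq ρ hρ u, variance_fun_neg]
    refine le_trans ?_ (wilson_variance_ge_allCouplings (d := d) (L := L) ρ hd hL hρ hρu u)
    have hvn : 0 ≤ variance (fun g => (ρ g).trace.re) (haarProbability G) := variance_nonneg _ _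
    have hu' : |u| ≤ B := abs_le.2 ⟨by linarith [hu.1], by linarith [hu.2]⟩
    have hc : 0 ≤ (2 * N * ((d + 1) * d ^ 2 : ℕ) * (1 + 4 * ((d + 1) * d ^ 2 : ℕ)) : ℝ) := by positivity
    rw [hm_def]
    gcongr
  have h := st_level_lagOneAutocorr_ge_kfree (μ := trivialMeasure G d L) (measurable_neg_wilsonAction ρ hρ)
    (neg_wilsonAction_bounded ρ hρ) hab hm0 hfloor hK κ hinv hnn hup hdown
  refine le_trans (le_of_eq ?_) h
  rw [hm_def, Real.exp_neg]
  field_simp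

end Wilson

end Summit.Ventures.LatticeQCDFlow.Scaling

end
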